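import Literature.AlgebraicGeometry.Frobenioids.ArchimedeanFSMLifting
import Literature.AlgebraicGeometry.Frobenioids.ArchimedeanFSMMono
import Literature.AlgebraicGeometry.Frobenioids.ArchimedeanIsotropyPropagation
import HarnessLib

/-!
# Frobenioids II, Proposition 3.4 (vi), FSMI clause: PROOF over an arbitrary base (tower `N`)
# (abc-iut cell, layer L1, node `FrdII:Prop3.4(vi)`; FACT-LIST row F-0823 `ArchFrd.Tower.PropVI_FSMI`)

Mochizuki, *The geometry of Frobenioids II: poly-Frobenioids*, Kyushu J. Math. **62** (2008)
401–460, §3, Proposition 3.4 (vi) p. 30 [cite: MochizukiFrdII2008, Prop 3.4 (vi) p.30]: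

> "(vi) … In particular, irreducible morphisms of `F` project to either isomorphisms or irreducible
> morphisms of `D`; FSMI-morphisms of `F` project to either isomorphisms or FSMI-morphisms of `D`."

(author's kurims text p. 30 ll. 20–22; the cross-reference to item (iii) is in the PROOF, p. 31
ll. 27–29: "Assertion (vi) follows immediately from the fact that if `α_{D₀} ∘ β_{D₀}` is any composite
morphism of `D₀`, then either `α_{D₀}` or `β_{D₀}` is an isomorphism [cf. also assertion (iii)]" — the
statement file's docstring of `Tower.PropVI_FSMI` carries that bracket inside the statement.)

PROOF-ONLY companion of `ArchimedeanFSM.lean` (statements, seat abc-iut-L1-t6); nothing is defined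
here. The tree so far derives the FSMI clause `Tower.PropVI_FSMI` from item (iii)
(`Tower.propVI_FSMI_of_propVI_of_propIII`), and item (iii) is FALSE as typed
(`ArchFrd.not_prop34_iii_id`, base `π = 𝟭 D₀`). PROVED here: **the FSMI clause holds as typed, over
EVERY base `π : D ⥤ D₀`, for the non-rigidified angloid `F = N`** (`N.propVI_FSMI`; the towers `A`,
`R` are treated in the sibling files `ArchimedeanFSMIProjectionA/R.lean`). The only ingredient beyond
the main clause of (vi) (`prop34_vi_irreducible`) and item (i) (`prop34_i_holds`) is that an
FSMI-morphism `φ` of `F` projects to a MONOMORPHISM of `D` (`N.mono_toD_of_isFSMI`):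
* if `φ` projects to an isomorphism of `D₀` this is condition (a) of item (ii) (`N.propII_condA`);
* otherwise `φ : P → Q` lies over `Spec ℂ → Spec ℝ`. Irreducibility forces the angular region of
  `P` to be isotropic (else `φ` factors through the naive isotropic hull of `P`, and neither factor
  is invertible — the argument of `N.not_isFSMI_complex_real_id` at `π = 𝟭`); and for an isotropic
  `P` monomorphy DESCENDS: two arrows `u, v : E → P_D` of `D` equalized by `φ_D` lift to arrows
  `(τ_u, 1, s_u), (τ_v, 1, s_v)` of `F` out of one object over `E` (twist `τ_w = π(w)` read through the
  identifications, scalar `s_w = c · τ_w(c)⁻¹`, `c` the scalar of `φ`) having the SAME composite with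
  `φ`, so `u = v`.
No statement of the paper is strengthened (the typed clause is proved as typed); no side is taken on
[IUTchIII] Cor. 3.12.
-/

namespace Literature.AlgebraicGeometry.Frobenioids

open CategoryTheory Set
open scoped Pointwise

noncomputable section

namespace ArchFrd

universe v u

/-! ### Two facts about `D₀` -/

/-- Every arrow of `D₀` into `Spec ℂ` is an isomorphism (it is an element of `Gal(ℂ/ℝ)`).
[cite: MochizukiFrdII2008, §3 p.23] -/
theorem D0.isIso_of_hom_complex {K : D0} (f : K ⟶ D0.complex) : IsIso f := by
  obtain rfl := D0.eq_complex_of_hom_complex f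
  rcases D0.hom_complex_complex_eq f with rfl | rfl
  · infer_instance
  · exact ⟨⟨D0.conj, D0.conj_comp_conj, D0.conj_comp_conj⟩⟩

/-- A non-invertible arrow of `D₀` is the structure arrow `Spec ℂ → Spec ℝ`: its source is `Spec ℂ`
and its target is `Spec ℝ`. [cite: MochizukiFrdII2008, §3 p.23] -/
theorem D0.eq_of_not_isIso {K L : D0} (f : K ⟶ L) (hf : ¬ IsIso f) :
    K = D0.complex ∧ L = D0.real := by
  cases L with
  | complex => exact (hf (D0.isIso_of_hom_complex f)).elim
  | real =>
    cases K with
    | complex => exact ⟨rfl, rfl⟩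
    | real =>
      rw [D0.hom_real_real_eq_id f] at hf
      exact (hf inferInstance).elim

/-! ### Twisted endomorphisms of an isotropic complex object of `C₀` -/

/-- A `d`-th root on the unit circle. [cite: MochizukiFrdII2008, Lem 3.2 (ii) p.26] -/
private theorem exists_unit_pow_eq (w : ℂˣ) (hw : absHom ℂ w = 1) (d : ℕ+) :
    ∃ s : ℂˣ, s ^ (d : ℕ) = w ∧ absHom ℂ s = 1 := by
  obtain ⟨z, hz⟩ := IsAlgClosed.exists_pow_nat_eq (w : ℂ) d.pos
  have hz0 : z ≠ 0 := by
    intro h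
    rw [h, zero_pow d.ne_zero] at hz
    exact w.ne_zero hz.symm
  refine ⟨Units.mk0 z hz0, Units.ext (by simp [hz]), ?_⟩
  have h1 : ‖(w : ℂ)‖ = 1 := by
    have := congrArg (fun r : PosReal => (r : ℝ)) hw
    rwa [coe_absHom] at this
  have hn : ‖z‖ ^ (d : ℕ) = 1 := by rw [← norm_pow, hz, h1]
  have hz1 : ‖z‖ = 1 := (pow_eq_one_iff_of_nonneg (norm_nonneg z) d.ne_zero).mp hn
  exact Subtype.ext (by rw [coe_absHom]; exact hz1)

/-- **Twisted endomorphisms with prescribed composite.** Let `P = (Spec ℂ, A_P)` be a complex object of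
`C₀` with ISOTROPIC angular region and `φ₀ : P → Q` an arrow to a real object. For every
`τ ∈ Gal(ℂ/ℝ)` there is a linear isometry `x = (τ, 1, s) : P → P` over `τ` with `x ≫ φ₀ = φ₀`
(take `s` with `s^{deg φ₀} = c · τ(c)⁻¹`, `c` the scalar of `φ₀`; `|s| = 1`, and an isotropic
region is stable under twists and unit scalars). [cite: MochizukiFrdII2008, Ex 3.3 (i) p.27] -/
theorem C0.exists_twist_endo_comp_eq {RP : AngularRegion ℂ}
    (hRP : D0.complex = D0.real → RP.IsIsotropic) (hisoP : RP.IsIsotropic)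
    {RQ : AngularRegion ℂ} (hRQ : D0.real = D0.real → RQ.IsIsotropic)
    (φ0 : C0.mk D0.complex RP hRP ⟶ C0.mk D0.real RQ hRQ) (τ : D0.complex ⟶ D0.complex) :
    ∃ x0 : C0.mk D0.complex RP hRP ⟶ C0.mk D0.complex RP hRP,
      C0.Base x0 = τ ∧ C0.degFr x0 = 1 ∧ PreFrobenioid.IsIsometry C0.toElem x0 ∧ x0 ≫ φ0 = φ0 := by
  set c : ℂˣ := C0.scalar φ0 with hc
  set d : ℕ+ := C0.degFr φ0 with hd
  have hw : absHom ℂ (c * (τ.act c)⁻¹) = 1 := by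
    rw [map_mul, map_inv]
    unfold D0.Hom.act
    rw [C0.absHom_galAct, mul_inv_cancel]
  obtain ⟨s, hsd, hs1⟩ := exists_unit_pow_eq _ hw d
  have hmb : s • (C0.mk D0.complex RP hRP).region.carrier ^ ((1 : ℕ+) : ℕ) ⊆
      C0.pullRegion (C0.mk D0.complex RP hRP) τ := by
    rw [PNat.one_coe, pow_one]
    rintro _ ⟨u, hu, rfl⟩
    show s • u ∈ τ.act '' RP.carrier
    unfold D0.Hom.act
    rw [C0.image_galAct_of_isIsotropic hisoP, C0.mem_carrier_of_isIsotropic hisoP, smul_eq_mul,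
      map_mul, hs1, one_mul]
    exact hu.2
  have hmem : s ∈ D0.scalars (C0.mk D0.complex RP hRP).base := by
    show _ ∈ D0.scalars D0.complex
    rw [D0.scalars_complex]
    exact Subgroup.mem_top _
  let x0 : C0.mk D0.complex RP hRP ⟶ C0.mk D0.complex RP hRP := ⟨τ, 1, s, hmem, hmb⟩
  have hx0I : PreFrobenioid.IsIsometry C0.toElem x0 := by
    rw [A0.isIsometry_iff_norm_mul_tip_pow]
    show ‖((s : ℂˣ) : ℂ)‖ * (RP.tip : ℝ) ^ ((1 : ℕ+) : ℕ) = (RP.tip : ℝ)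
    rw [← coe_absHom, hs1, Positive.val_one, one_mul, PNat.one_coe, pow_one]
  refine ⟨x0, rfl, rfl, hx0I, ?_⟩
  refine C0.hom_ext ((D0.hom_complex_real_eq _).trans (D0.hom_complex_real_eq _).symm) ?_ ?_
  · rw [C0.degFr_comp']
    exact one_mul _
  · rw [C0.scalar_comp']
    show τ.act c * s ^ (d : ℕ) = c
    rw [hsd, mul_left_comm, mul_inv_cancel, mul_one]

/-- **The naive isotropic hull factorization.** Let `P = (Spec ℂ, A_P)` be a complex object of `C₀`
whose angular region is NOT isotropic and `φ₀ : P → Q` an isometry to a real object. Then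
`φ₀ = β₀ ≫ α₀` through the isotropic object `P' = (Spec ℂ, |A_P|)` of the same tip, with
`β₀ = (id, 1, 1)` and `α₀ = (Base φ₀, deg φ₀, c_{φ₀})`, both isometries.
[cite: MochizukiFrdII2008, Ex 3.3 (i) p.27] -/
theorem C0.exists_hull_fac {RP : AngularRegion ℂ} (hRP : D0.complex = D0.real → RP.IsIsotropic)
    {RQ : AngularRegion ℂ} (hRQ : D0.real = D0.real → RQ.IsIsotropic)
    (φ0 : C0.mk D0.complex RP hRP ⟶ C0.mk D0.real RQ hRQ)
    (hI : PreFrobenioid.IsIsometry C0.toElem φ0) :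
    ∃ (β0 : C0.mk D0.complex RP hRP ⟶
        C0.mk D0.complex (AngularRegion.isotropicOfTip RP.tip) (fun h => nomatch h))
      (α0 : C0.mk D0.complex (AngularRegion.isotropicOfTip RP.tip) (fun h => nomatch h) ⟶
        C0.mk D0.real RQ hRQ),
      β0 ≫ α0 = φ0 ∧ C0.Base β0 = 𝟙 D0.complex ∧ C0.degFr β0 = 1 ∧
        PreFrobenioid.IsIsometry C0.toElem β0 ∧ C0.degFr α0 = C0.degFr φ0 ∧
        PreFrobenioid.IsIsometry C0.toElem α0 := by
  set d : ℕ+ := C0.degFr φ0 with hddef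
  have hφt : ‖((C0.scalar φ0 : ℂˣ) : ℂ)‖ * (RP.tip : ℝ) ^ (d : ℕ) = (RQ.tip : ℝ) :=
    (A0.isIsometry_iff_norm_mul_tip_pow φ0).mp hI
  let RP' : AngularRegion ℂ := AngularRegion.isotropicOfTip RP.tip
  have hRP' : D0.complex = D0.real → RP'.IsIsotropic := fun h => nomatch h
  have hisoP' : RP'.IsIsotropic := AngularRegion.isIsotropic_isotropicOfTip _
  have hmβ : (1 : ℂˣ) • (C0.mk D0.complex RP hRP).region.carrier ^ ((1 : ℕ+) : ℕ) ⊆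
      C0.pullRegion (C0.mk D0.complex RP' hRP') (𝟙 D0.complex) := by
    rw [one_smul, PNat.one_coe, pow_one, C0.pullRegion_id]
    intro u hu
    rw [C0.mem_carrier_of_isIsotropic hisoP']
    exact hu.2
  let β0 : C0.mk D0.complex RP hRP ⟶ C0.mk D0.complex RP' hRP' := ⟨𝟙 D0.complex, 1, 1, one_mem _, hmβ⟩
  have hβI : PreFrobenioid.IsIsometry C0.toElem β0 := by
    rw [A0.isIsometry_iff_norm_mul_tip_pow]
    show ‖((1 : ℂˣ) : ℂ)‖ * (RP.tip : ℝ) ^ ((1 : ℕ+) : ℕ) = (RP.tip : ℝ)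
    rw [Units.val_one, norm_one, one_mul, PNat.one_coe, pow_one]
  have hmα : C0.scalar φ0 • (C0.mk D0.complex RP' hRP').region.carrier ^ (d : ℕ) ⊆
      C0.pullRegion (C0.mk D0.real RQ hRQ) (C0.Base φ0) := by
    have hq : C0.pullRegion (C0.mk D0.real RQ hRQ) (C0.Base φ0) = RQ.carrier := by
      show (C0.Base φ0).act '' RQ.carrier = RQ.carrier
      unfold D0.Hom.act
      rw [D0.twists_of_real, D0.image_galAct_false]
    rw [hq, ← d.natPred_add_one]
    refine (RP'.smul_carrier_pow_subset_iff RQ (C0.scalar φ0) d.natPred).mpr ⟨?_, ?_⟩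
    · rw [show RQ.dir = univ from hRQ rfl]
      exact subset_univ _
    · rw [d.natPred_add_one, ← Subtype.coe_le_coe]
      show (absHom ℂ (C0.scalar φ0) : ℝ) * ((RP.tip : ℝ) ^ (d : ℕ)) ≤ (RQ.tip : ℝ)
      rw [coe_absHom, hφt]
  let α0 : C0.mk D0.complex RP' hRP' ⟶ C0.mk D0.real RQ hRQ :=
    ⟨(C0.Base φ0 :), d, C0.scalar φ0, φ0.scalar_mem, hmα⟩
  have hαI : PreFrobenioid.IsIsometry C0.toElem α0 := by
    rw [A0.isIsometry_iff_norm_mul_tip_pow]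
    show ‖((C0.scalar φ0 : ℂˣ) : ℂ)‖ * (RP.tip : ℝ) ^ (d : ℕ) = (RQ.tip : ℝ)
    exact hφt
  have hβα : β0 ≫ α0 = φ0 := by
    refine C0.hom_ext ((D0.hom_complex_real_eq _).trans (D0.hom_complex_real_eq _).symm) ?_ ?_
    · rw [C0.degFr_comp']
      exact one_mul _
    · rw [C0.scalar_comp']
      show D0.galAct (D0.Hom.twists (𝟙 D0.complex)) (C0.scalar φ0) * 1 ^ (d : ℕ) = C0.scalar φ0
      rw [D0.twists_id, D0.galAct_false, one_pow, mul_one]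
  exact ⟨β0, α0, hβα, rfl, rfl, hβI, rfl, hαI⟩

/-- There is no arrow of `C₀` from an isotropic complex object `(Spec ℂ, |A|)` to a complex object whose
angular region is not isotropic (isotropy propagates along arrows, Ex. 3.3 (ii)).
[cite: MochizukiFrdII2008, Ex 3.3 (ii) p.28] -/
theorem C0.not_isIsotropic_elim {RP : AngularRegion ℂ} (hRP : D0.complex = D0.real → RP.IsIsotropic)
    (hisoP : ¬ RP.IsIsotropic) {t : PosReal}
    (g : C0.mk D0.complex (AngularRegion.isotropicOfTip t) (fun h => nomatch h) ⟶
      C0.mk D0.complex RP hRP) : False :=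
  hisoP (C0.isNaivelyIsotropic_of_hom g (AngularRegion.isIsotropic_isotropicOfTip t))

variable {D : Type u} [Category.{v} D] (π : D ⥤ D0)

/-! ### The tower `N`: FSMI-morphisms project to monomorphisms of `D` -/

/-- **Monomorphy descends for `N`, complex isotropic domain over a real codomain.** Over an arbitrary
base `π : D ⥤ D₀`: a monomorphism `φ : P → Q` of `N` with `P = ((Spec ℂ, A_P), P_D, ι_P)`, `A_P`
isotropic, and `Q` over `Spec ℝ` projects to a monomorphism `φ_D` of `D` — two arrows `u, v : E → P_D`
with `u ≫ φ_D = v ≫ φ_D` lift to arrows of `N` out of `((Spec ℂ, A_P), E, ·)` with equal composites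
with `φ` (`C0.exists_twist_endo_comp_eq`). [cite: MochizukiFrdII2008, Prop 3.4 (vi) p.30] -/
theorem N.mono_toD_of_mono_of_isIsotropic {RP : AngularRegion ℂ}
    (hRP : D0.complex = D0.real → RP.IsIsotropic) (hisoP : RP.IsIsotropic) {PD : D}
    (ιP : (PreFrobenioid.baseFunctor C0.toElem).obj (C0.mk D0.complex RP hRP) ≅ π.obj PD)
    {RQ : AngularRegion ℂ} (hRQ : D0.real = D0.real → RQ.IsIsotropic) {QD : D}
    (ιQ : (PreFrobenioid.baseFunctor C0.toElem).obj (C0.mk D0.real RQ hRQ) ≅ π.obj QD)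
    (φ : (⟨⟨⟨C0.mk D0.complex RP hRP, PD, ιP⟩⟩⟩ : N π) ⟶ ⟨⟨⟨C0.mk D0.real RQ hRQ, QD, ιQ⟩⟩⟩)
    [Mono φ] : Mono ((towerN π).toD.map φ) := by
  refine ⟨fun {E} u v huv => ?_⟩
  change u ≫ φ.hom.hom.snd = v ≫ φ.hom.hom.snd at huv
  set φ0 := φ.hom.hom.fst with hφ0def
  -- `E` lies over `Spec ℂ`
  have hE : π.obj E = D0.complex :=
    D0.eq_complex_of_hom_complex (π.map u ≫ ιP.inv : π.obj E ⟶ D0.complex)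
  let ιV : (PreFrobenioid.baseFunctor C0.toElem).obj (C0.mk D0.complex RP hRP) ≅ π.obj E :=
    eqToIso hE.symm
  let VC : C π := ⟨C0.mk D0.complex RP hRP, E, ιV⟩
  let V : N π := ⟨⟨VC⟩⟩
  let PC : C π := ⟨C0.mk D0.complex RP hRP, PD, ιP⟩
  let P : N π := ⟨⟨PC⟩⟩
  -- the lift of an arrow `w : E → P_D` to an arrow `V → P` of `N` with composite `φ₀` downstairs
  have lift : ∀ w : E ⟶ PD, ∃ x : V ⟶ P, x.hom.hom.fst ≫ φ0 = φ0 ∧ x.hom.hom.snd = w := by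
    intro w
    obtain ⟨x0, hb, hd, hI, hcomp⟩ :=
      C0.exists_twist_endo_comp_eq hRP hisoP hRQ φ0 (ιV.hom ≫ π.map w ≫ ιP.inv)
    have sq : (PreFrobenioid.baseFunctor C0.toElem).map x0 ≫ ιP.hom = ιV.hom ≫ π.map w := by
      have hb' : (PreFrobenioid.baseFunctor C0.toElem).map x0 = ιV.hom ≫ π.map w ≫ ιP.inv := hb
      rw [hb', Category.assoc, Category.assoc, ιP.inv_hom_id, Category.comp_id]
    let xC : VC ⟶ PC := ⟨x0, w, sq⟩
    have hxiso : PreFrobenioid.isometricMorphisms (C.toElem π) xC := hI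
    have hxlin : PreFrobenioid.linearMorphisms (A.toElem π) (⟨xC, hxiso⟩ : V.obj ⟶ P.obj) := hd
    exact ⟨⟨⟨xC, hxiso⟩, hxlin⟩, hcomp, rfl⟩
  obtain ⟨a, ha0, haD⟩ := lift u
  obtain ⟨b, hb0, hbD⟩ := lift v
  have hab : a ≫ φ = b ≫ φ := by
    apply WideSubcategory.hom_ext
    apply WideSubcategory.hom_ext
    refine CFP.hom_ext ?_ ?_
    · show a.hom.hom.fst ≫ φ0 = b.hom.hom.fst ≫ φ0
      rw [ha0, hb0]
    · show a.hom.hom.snd ≫ φ.hom.hom.snd = b.hom.hom.snd ≫ φ.hom.hom.snd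
      rw [haD, hbD]
      exact huv
  have h := congrArg (fun f => f.hom.hom.snd) ((cancel_mono φ).mp hab)
  simp only [haD, hbD] at h
  exact h

/-- **An FSMI-morphism of `N` projects to a monomorphism of `D`**, over an arbitrary base
`π : D ⥤ D₀`. If `φ` projects to an isomorphism of `D₀` this is condition (a) of Prop. 3.4 (ii)
(`N.propII_condA`). Otherwise `φ : P → Q` lies over `Spec ℂ → Spec ℝ`; the angular region of `P` is
isotropic — else `φ` factors through the naive isotropic hull of `P` (`C0.exists_hull_fac`) with
neither factor invertible, contradicting irreducibility — and then monomorphy descends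
(`N.mono_toD_of_mono_of_isIsotropic`). [cite: MochizukiFrdII2008, Prop 3.4 (vi) p.30] -/
theorem N.mono_toD_of_isFSMI {P Q : N π} (φ : P ⟶ Q) (hφ : IsFSMI φ) :
    Mono ((towerN π).toD.map φ) := by
  by_cases hA : IsIso ((towerN π).toD0.map φ)
  · exact N.propII_condA π φ hφ.1.2 hA
  obtain ⟨⟨⟨⟨KP, RP, hRP⟩, PD, ιP⟩⟩⟩ := P
  obtain ⟨⟨⟨⟨KQ, RQ, hRQ⟩, QD, ιQ⟩⟩⟩ := Q
  set φ0 := φ.hom.hom.fst with hφ0def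
  -- the base arrow of `φ₀` is not invertible, so it is `Spec ℂ → Spec ℝ`
  have hB : ¬ IsIso ((PreFrobenioid.baseFunctor C0.toElem).map φ0) := by
    intro h
    apply hA
    have hw : (PreFrobenioid.baseFunctor C0.toElem).map φ0 ≫ ιQ.hom = ιP.hom ≫ π.map φ.hom.hom.snd :=
      φ.hom.hom.w
    change IsIso (π.map φ.hom.hom.snd)
    rw [← (Iso.inv_comp_eq ιP).mpr hw]
    infer_instance
  have hKP : KP = D0.complex := (D0.eq_of_not_isIso (C0.Base φ0) hB).1
  have hKQ : KQ = D0.real := (D0.eq_of_not_isIso (C0.Base φ0) hB).2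
  subst hKP hKQ
  haveI := hφ.1.2
  by_cases hisoP : RP.IsIsotropic
  · exact N.mono_toD_of_mono_of_isIsotropic π hRP hisoP ιP hRQ ιQ φ
  · -- factor through the naive isotropic hull: neither factor is an isomorphism
    exfalso
    have hd : C0.degFr φ0 = 1 := φ.property
    have hI : PreFrobenioid.IsIsometry C0.toElem φ0 := φ.hom.property
    obtain ⟨β0, α0, hβα, hbβ, hdβ, hβI, hdα, hαI⟩ := C0.exists_hull_fac hRP hRQ φ0 hI
    let RP' : AngularRegion ℂ := AngularRegion.isotropicOfTip RP.tip
    have hRP' : D0.complex = D0.real → RP'.IsIsotropic := fun h => nomatch h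
    let PC : C π := ⟨C0.mk D0.complex RP hRP, PD, ιP⟩
    let PN : N π := ⟨⟨PC⟩⟩
    let P'C : C π := ⟨C0.mk D0.complex RP' hRP', PD, ιP⟩
    let P' : N π := ⟨⟨P'C⟩⟩
    let QC : C π := ⟨C0.mk D0.real RQ hRQ, QD, ιQ⟩
    let QN : N π := ⟨⟨QC⟩⟩
    have sqβ : (PreFrobenioid.baseFunctor C0.toElem).map β0 ≫ ιP.hom = ιP.hom ≫ π.map (𝟙 PD) := by
      show C0.Base β0 ≫ ιP.hom = ιP.hom ≫ π.map (𝟙 PD)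
      rw [hbβ, π.map_id]
      exact (Category.id_comp _).trans (Category.comp_id _).symm
    let βC : PC ⟶ P'C := ⟨β0, 𝟙 PD, sqβ⟩
    have hβiso : PreFrobenioid.isometricMorphisms (C.toElem π) βC := hβI
    have hβlin : PreFrobenioid.linearMorphisms (A.toElem π) (⟨βC, hβiso⟩ : PN.obj ⟶ P'.obj) := hdβ
    let β : PN ⟶ P' := ⟨⟨βC, hβiso⟩, hβlin⟩
    have wα : (PreFrobenioid.baseFunctor C0.toElem).map α0 ≫ ιQ.hom = ιP.hom ≫ π.map φ.hom.hom.snd := by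
      have hw : (PreFrobenioid.baseFunctor C0.toElem).map φ0 ≫ ιQ.hom = ιP.hom ≫ π.map φ.hom.hom.snd :=
        φ.hom.hom.w
      have hbα : C0.Base α0 = C0.Base φ0 :=
        (D0.hom_complex_real_eq _).trans (D0.hom_complex_real_eq _).symm
      change C0.Base α0 ≫ ιQ.hom = ιP.hom ≫ π.map φ.hom.hom.snd
      rw [hbα]
      exact hw
    let αC : P'C ⟶ QC := ⟨α0, φ.hom.hom.snd, wα⟩
    have hαiso : PreFrobenioid.isometricMorphisms (C.toElem π) αC := hαI
    have hαlin : PreFrobenioid.linearMorphisms (A.toElem π) (⟨αC, hαiso⟩ : P'.obj ⟶ QN.obj) :=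
      hdα.trans hd
    let α : P' ⟶ QN := ⟨⟨αC, hαiso⟩, hαlin⟩
    have hfac : β ≫ α = φ := by
      apply WideSubcategory.hom_ext
      apply WideSubcategory.hom_ext
      exact CFP.hom_ext hβα (Category.id_comp _)
    rcases hφ.2.2 β α hfac with hα | hβ
    · haveI := hα
      exact (D0.isEmpty_hom_real_complex.false (C0.Base (inv α).hom.hom.fst)).elim
    · haveI := hβ
      exact C0.not_isIsotropic_elim hRP hisoP (inv β).hom.hom.fst

/-- **Proposition 3.4 (vi), FSMI clause, for `F = N` — PROVED AS TYPED over every base**: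
"FSMI-morphisms of `F` project to either isomorphisms or FSMI-morphisms of `D`" — fiberwise-surjective
by item (i) (`prop34_i_holds`), mono by `N.mono_toD_of_isFSMI`, irreducible-or-invertible by the main
clause of (vi) (`prop34_vi_irreducible`). [cite: MochizukiFrdII2008, Prop 3.4 (vi) p.30] -/
theorem N.propVI_FSMI : (towerN π).PropVI_FSMI := by
  intro P Q φ hφ
  rcases (prop34_vi_irreducible π).2.1 φ hφ.2 with hiso | hirr
  · exact Or.inl hiso
  · exact Or.inr ⟨⟨(prop34_i_holds π).2.1 φ hφ.1.1, N.mono_toD_of_isFSMI π φ hφ⟩, hirr⟩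

end ArchFrd

end

end Literature.AlgebraicGeometry.Frobenioids
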